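import Summits.BirchSwinnertonDyer.Rank1Residual.ManinAdditive.GrossThetaFourLaws
import HarnessLib
import HarnessLib.Audit.Tags

/-!
# bsd-f2-manin · desc g25 — TORIC PERIODS OF THE θ-BRANDT EIGENVECTOR, PART 3: the `p = 7` twin (θ₇-module of `(−1,−7)_ℚ` at `49 ∥ N`)

Continuation of `GrossThetaLaws.lean` (§0–§3) and `GrossThetaFourLaws.lean` (§4–§5) (desc g25, MEMO-desc §50.12): §6 the THIRD prime —
the θ₇-isotypic Brandt module of `B_{7,∞} = (−1,−7)_ℚ` (vocabulary `dnorm7`, `heptOfNorm`, `theta7Exp`, `act7`, `stabWeight7`,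
`IsThetaSevenEquivariant`, `thetaSevenHecke4`, `IsThetaSevenHeckeEigen`, `thetaSevenHeightTwo`, `IsEtaFixed`, Kodaira / 2-Eisenstein units at
`49`), rows L-desc-178d `TwistPeriodProductMinusSeven` (434 / 434), E-desc-183 `ThetaSevenBrandtDegreeLawAtFortyNinePrime` (194 / 194), E-desc-181
`GrossThetaSevenExactIdentityAtFortyNinePrime` (constant `1/(p+1) = 1/8` PREDICTED by §50.8 then CONFIRMED 25 / 25 + 32 / 32), E-desc-181′
`GrossThetaSevenBSDIdentityAtFortyNinePrime`; §7 proved edges `grossThetaSevenBSD_of_degreeForm` (E-181 ∧ E-183 ⊢ E-181′) and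
`thetaSeven_vanishes_iff_lAlg_of_identity`.  PART 1's module docstring carries the full framing; nothing is asserted here either
(every law is an `@[conjecture] def … : Prop`).

TYPER NOTE (typer g21, T-desc-47′, PART 3 of 3).  SOURCE = HOME/desc/g25/lean/Sketch-desc-g25.lean v4 sha16 85fce37c1af6a3ae (766 l.;
desc: farm rc 0·0·0·0, BC7 15/15 CLEAN probe4.out ddb9eed7bb9793af), lines 451–767 (§6–§7) VERBATIM — v4's lines 1–449 are byte-identical
to v3 b5ac38827fa0d8df, already landed as PART 1 `GrossThetaLaws.lean` (p755060) and PART 2 `GrossThetaFourLaws.lean` (p755080).  Typer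
deltas: (i) this header (imports PART 2; same `open` lines; the GrossTheta name space of parts 1–2 instead of the sketch's `DescG25`);
(ii) one-line docstrings added to the undocumented helpers `thetaSevenUnitTwo_ne_zero`, `thetaSevenUnitKodaira_ne_zero`,
`thetaSevenUnitTwo_eq_pow` (gate lint); (iii) bib key `FileMartinPitale2017` (File–Martin–Pitale, Algebra & Number Theory 11 (2017) 253–318,
doi:10.2140/ant.2017.11.253) ADDED to references.bib — the other keys (`SilvermanAEC2009`, `Gross1987Heights`, `CaiShuTian2014`,
`Connell1999`, `CremonaEcdata`, `PollackWeston2011`) were present.  REFUTER: ref1 R-desc-41′ / ref2 PENDING; -an audit E-desc-51′ PENDING.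
No instances, no notation, no sorry.  bears_on: stmt-BirchSwinnertonDyer-22969 (additive primes `p ≥ 5`: `49 ∥ N`) as a BSD-shape CHECK of
`c_E² = 1`, not an input.  BSD is not proved by this; C2/C3/C4 OPEN (priced «⟸ Stevens I (strong) via E-an-242, N6 ∧ N7 open», director
00:56Z). [cite: FileMartinPitale2017, Thm. 1.1 (the constant 1/8 on the θ₇-module is the cell's E-desc-181 via the §50.8 dictionary, NOT in print)]
-/

set_option autoImplicit false

noncomputable section

open scoped MatrixGroups ModularForm Classical

open CongruenceSubgroup WeierstrassCurve Literature.NumberTheory.EllipticCurves.ModularForms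
open Summit.BirchSwinnertonDyer.Rank1Residual.ManinAdditive.ConwayCut
open Summit.BirchSwinnertonDyer.Rank1Residual.ManinAdditive.TameTwoLocal
open Summit.BirchSwinnertonDyer.Rank1Residual.ManinAdditive.HasseDepth
open Summit.BirchSwinnertonDyer.Rank1Residual.ManinAdditive.HurwitzBrandt
open Summit.BirchSwinnertonDyer.Rank1Residual.ManinAdditive.ThetaBrandt
open Summit.BirchSwinnertonDyer.Rank1Residual.ManinAdditive.FrobeniusPairing
open Summit.BirchSwinnertonDyer.Rank1Residual.ManinAdditive.ThetaFourBrandt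

namespace Summit.BirchSwinnertonDyer.Rank1Residual.ManinAdditive.GrossTheta

/-! ### §6. The `p = 7` twin (memo §50.12; E-desc-181/183, L-desc-178d): the θ₇-isotypic Brandt module of `(−1,−7)_ℚ`,
`K = ℚ(√−7)`, constant `1/(p+1) = 1/8`

The THIRD prime.  `B_{7,∞} = (−1,−7)_ℚ`, maximal order `O₇ = ℤ⟨1, i, (1+j)/2, (i+k)/2⟩` (class number 1, the SAME parity
shape `DicParity` in doubled coordinates as the `p = 3` file, `4·Nrd = A² + B² + 7C² + 7D²`), FOUR units `±1, ±i`;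
`𝔓 = jO₇`, `O₇/𝔓 = 𝔽₄₉ = 𝔽₇[i]`; the depth-zero supercuspidal type of conductor `49` with trivial central character realised by
elliptic curves (`e = 4`, Kodaira III / III* at 7 — at `p = 7 ≡ 3 (mod 4)` every `e = 4` curve is supercuspidal, and there is ONE
such type: `E` and `E^{(−7)}` share it) is `Ind θ₇`, `θ₇(z) = z¹²` the character of ORDER 4 of `𝔽₄₉^×/𝔽₇^× ≅ ℤ/8`
(`θ₇ ≡ 1` on the four units; `θ₇(γ) = ±1` iff `Nrd γ` is a square mod 7, `±i` otherwise).  ENGINE `desc/g25/b7/brandt7.py`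
(selftest: 4 units, `θ₇` multiplicative of exact order 4, `#{Nrd = ℓ} = 4(ℓ+1)`, `j`-conjugation inverts `θ₇`; JL check: EVERY
optimal III/III* curve at `49M`, `M` odd `< 122`, has a unique verified eigenline, 67/67, and no other curve has one).
CM by `O_K = ℤ[η]`, `η = (1+j)/2` (reduced norm 2): the points of `ℙ¹(ℤ/M)` fixed by `η` — present iff every `q ∣ M` is
`≡ 1, 2, 4 (mod 7)`; `u_K = 2`, stabiliser weight `w(x_K) = 1`.
RESULTS (`desc/g25/b7/KAPPA49.txt`, `RHO7.txt`, `deg7.py` output; M odd):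
* E-desc-181 (MOD): `L(E,1)L(E^{(−7)},1)·√7·⟨m,m⟩ = ⅛·(f,f)_G·Nm(m_E(x_K))` — PREDICTED `1/(p+1) = 1/8` by §50.8, CONFIRMED
  `κ₄₉/4π² = 0.250000000000` on 25/25 ordered rank-0 pairs (13 unordered, incl. the CM self-pair 41209e) at the 19 habitat levels
  `M ≤ 850` carrying III/III* curves (prime `M ∈ {67, 71, 127, 239, 613, 631, 827}`, composite `253, 407, 781, 841`);
  `Nm = 0 ⟺ L·L' = 0` 32/32; `Nm` constant over the `η`-fixed orbits 57/57; AGM periods vs Cremona `Ω` ≤ 3.6e−15.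
* E-desc-183 (degree law): `deg φ = 2^{2+s}·7^{[III*]}·⟨m,m⟩`, `s ∈ {0,1}`, 194/194 optimal III/III* curves at `49M`, ALL odd
  `M ≤ 323` (+ 57/57 habitat rows to `M = 841`); `s = 0` iff `E` is 2-EISENSTEIN DEGENERATE AT 49: `E(ℚ)[2] ≠ 0`, `2 ∤ c_q`
  for `q ≠ 7`, and every `q ∥ N`, `q ≠ 7`, is `≡ 7 (mod 8)` (194/194; the `p = 3` congruence was `q ≡ 3 (mod 4)`, the `p = 2`
  one `q ≡ 2 (mod 3)`: uniformly `q ≡ −1 (mod p+1)`, E-desc-182).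
* E-desc-181′ (BSD form): `Nm(m_E(x_K)) = c_E²·c_∞·2^{[2-Eis. degenerate at 49]}·L_alg(E)·L_alg(E^{(−7)})`, 25/25 (`U ∈ {1,2,4}`);
  Ш-visibility: `11711b1`: `Nm = 9 = |Ш(11711b1)|` (Cremona), `12397l1`, `40523c1`: `|Ш| = 4 ∣ Nm = 32`.
* L-desc-178d (E-blind): `Ω(E)·Ω(E^{(−7)})·√7 = 2·c_∞·7^{[III*]}·A_E`, 434/434 optimal III/III* curves at `49M`, `M` odd `≤ 700`,
  ANY rank (twist MODEL by `(c₄, c₆)`).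
Nothing here is in print for the supercuspidal θ-module (searches of §50.5); the constant is an INSTANCE of [cite: FileMartinPitale2017,
Thm. 1.1] via the dictionary of §50.8.  All rows: nothing asserted. -/

/-- four times the reduced norm in `(−1,−7)`: `A² + B² + 7C² + 7D²`. [folklore] -/
def dnorm7 (q : DQuat) : ℤ := q.1 ^ 2 + q.2.1 ^ 2 + 7 * q.2.2.1 ^ 2 + 7 * q.2.2.2 ^ 2

/-- ALL elements of `O₇` of reduced norm `r`, in doubled coordinates (`4(r+1)` of them for a prime `r ≠ 7`). [folklore] -/
def heptOfNorm (r : ℕ) : List DQuat :=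
  let m : ℕ := Nat.sqrt (4 * r)
  let cs : List ℤ := (List.range (2 * m + 1)).map (fun t => (t : ℤ) - m)
  (cs.flatMap fun a => cs.flatMap fun b => cs.flatMap fun c => cs.map fun d => ((a, b, c, d) : DQuat)).filter
    (fun q => decide (DicParity q) && dnorm7 q == 4 * (r : ℤ))

/-- the 4 units `±1, ±i` of `O₇` (`O₇^×/±1 ≅ C₂`). [folklore] -/
def heptUnits : List DQuat := heptOfNorm 1

/-- multiplication in `𝔽₄₉ = 𝔽₇[i]` on residue pairs `(x, y) ↔ x + y·i`. [folklore] -/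
def f49Mul (u v : ℤ × ℤ) : ℤ × ℤ := ((u.1 * v.1 - u.2 * v.2) % 7, (u.1 * v.2 + u.2 * v.1) % 7)

/-- `θ̃₇(q) ∈ {0,1,2,3}`: `θ₇(q) = i^{θ̃₇(q)}`, `θ₇(q) := (q mod 𝔓)¹² ∈ μ₄(𝔽₄₉)`, `q mod 𝔓 = x + y·i`, `x = 4A`, `y = 4B (mod 7)`
(`1/2 ≡ 4`; `j, k ∈ 𝔓`); junk `0` on `𝔓`. [folklore] -/
def theta7Exp (q : DQuat) : ℕ :=
  let z : ℤ × ℤ := ((4 * q.1) % 7, (4 * q.2.1) % 7)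
  let z2 := f49Mul z z
  let z4 := f49Mul z2 z2
  let z8 := f49Mul z4 z4
  let z12 := f49Mul z8 z4
  if z12 = (1, 0) then 0 else if z12 = (0, 1) then 1 else if z12 = (6, 0) then 2 else if z12 = (0, 6) then 3 else 0

/-- a pair `(a, b)` of residues with `a² + b² + 7 ≡ 0 (mod p)` (first in lexicographic order; exists for every odd prime `p ≠ 7`). [folklore] -/
def negSevenAsSumOfTwoSquares (p : ℕ) : ℕ × ℕ :=
  (((List.range p).flatMap fun a => (List.range p).map fun b => (a, b)).find?
    (fun ab => (ab.1 ^ 2 + ab.2 ^ 2 + 7) % p == 0)).getD (0, 0)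

/-- the action of `O₇` on `ℙ¹(𝔽_p)`: the `p = 3` file's `act3With` (whose matrices `I = (0 −1; 1 0)`, `J = (a b; b −a)`, `K = IJ`
are shape-generic) with `(a, b)` a solution of `a² + b² ≡ −7`. [folklore] -/
def act7 (p : ℕ) (q : DQuat) (x : Fin (p + 1)) : Fin (p + 1) :=
  act3With p (negSevenAsSumOfTwoSquares p).1 (negSevenAsSumOfTwoSquares p).2 q x

/-- `w(x) = |Stab_{O₇^×}(x)|/2 ∈ {1, 2}` (`2` iff `i` fixes `x`). [folklore] -/
def stabWeight7 (p : ℕ) (x : Fin (p + 1)) : ℕ :=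
  (heptUnits.filter fun u => decide (act7 p u x = x)).length / 2

/-- θ₇-EQUIVARIANCE of `g : ℙ¹(𝔽_p) → ℤ[i]` (θ₇ ≡ 1 on the four units, so this is plain `O₇^×`-invariance, kept in the θ-shape
of the `p = 2, 3` files); `𝓜_θ₇(p)` = these functions, `θ₇` entering through the Hecke operators only. [folklore] -/
def IsThetaSevenEquivariant (p : ℕ) (g : Fin (p + 1) → ZI) : Prop :=
  ∀ u ∈ heptUnits, ∀ x : Fin (p + 1), ZI.iPowMul (theta7Exp u) (g (act7 p u x)) = g x

/-- the WEIGHTED function `f = W g`, `f(x) = w(x)·g(x)`. [folklore] -/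
def weightMul7 (p : ℕ) (g : Fin (p + 1) → ZI) (x : Fin (p + 1)) : ZI :=
  ((stabWeight7 p x : ℤ) * (g x).1, (stabWeight7 p x : ℤ) * (g x).2)

/-- `4 · T_ℓ` on point functions: `(T₄ f)(x) = Σ_{γ ∈ O₇, Nrd γ = ℓ} i^{θ̃₇(γ)} · f(γ·x)` (all `4(ℓ+1)` elements of reduced norm a
prime `ℓ ∤ 7p`, `ℓ = 2` allowed).  On `𝓜_θ₇` the eigenvalue systems are `(a_ℓ(E))` AND `((ℓ/7)·a_ℓ(E)) = (a_ℓ(E^{(−7)}))` —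
both twists live in the one module. [folklore] -/
def thetaSevenHecke4 (p ℓ : ℕ) (f : Fin (p + 1) → ZI) (x : Fin (p + 1)) : ZI :=
  ((heptOfNorm ℓ).map fun γ => ZI.iPowMul (theta7Exp γ) (f (act7 p γ x))).foldr ZI.add (0, 0)

/-- `f = W g` is a HECKE EIGENFUNCTION with eigenvalues `a`: `T₄,ℓ f = 4 a_ℓ · f` for every prime `ℓ ∤ 7p`. [folklore] -/
def IsThetaSevenHeckeEigen (p : ℕ) (g : Fin (p + 1) → ZI) (a : ℕ → ℤ) : Prop :=
  ∀ ℓ : ℕ, ℓ.Prime → ℓ ≠ 7 → ℓ ≠ p → ∀ x : Fin (p + 1),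
    thetaSevenHecke4 p ℓ (weightMul7 p g) x = (4 * a ℓ * (weightMul7 p g x).1, 4 * a ℓ * (weightMul7 p g x).2)

/-- TWICE THE GROSS HEIGHT: `2·⟨m, m⟩ = Σ_{x ∈ ℙ¹(𝔽_p)} w(x)²·Nm g(x)` (an orbit `o` has `2 / w_o` points). [folklore] -/
def thetaSevenHeightTwo (p : ℕ) (g : Fin (p + 1) → ZI) : ℤ :=
  ((List.finRange (p + 1)).map fun x => (stabWeight7 p x : ℤ) ^ 2 * ZI.norm (g x)).sum

/-- the CM points by `O_K`, `K = ℚ(√−7)`: `x` fixed by `η = (1+j)/2` (doubled `(1,0,1,0)`); present iff `p ≡ 1, 2, 4 (mod 7)`,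
then `2` of them, swapped by `i`. [folklore] -/
def IsEtaFixed (p : ℕ) (x : Fin (p + 1)) : Prop :=
  act7 p ((1, 0, 1, 0) : DQuat) x = x

/-- Kodaira type III at `7` on the tame cell `49 ∥ N` (globally minimal `W`): `v₇(Δ) = 3`. [folklore] -/
def IsTypeThreeAtSevenTame (W : WeierstrassCurve ℚ) : Prop :=
  padicValNat 7 (W.conductorNorm ℤ) = 2 ∧ padicValRat 7 W.Δ = 3

/-- Kodaira type III* at `7` on `49 ∥ N`: `v₇(Δ) = 9` with potentially GOOD reduction (`c₄ = 0` or `3·v₇(c₄) ≥ 9`, excluding `I₃*`). [folklore] -/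
def IsTypeThreeStarAtSevenTame (W : WeierstrassCurve ℚ) : Prop :=
  padicValNat 7 (W.conductorNorm ℤ) = 2 ∧ padicValRat 7 W.Δ = 9 ∧ (W.c₄ = 0 ∨ 9 ≤ 3 * padicValRat 7 W.c₄)

/-- `7^{b(W)}`: `7` iff `W` is III* at `7`, else `1`. [folklore] -/
def thetaSevenUnitKodaira (W : WeierstrassCurve ℚ) : ℝ :=
  if IsTypeThreeStarAtSevenTame W then 7 else 1

/-- **2-Eisenstein degeneracy at `49 ∥ N`** (E-desc-183's criterion `s(E) = 0`; the twin of `IsTwoEisensteinDegenerateAtNine` /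
`IsThreeEisensteinDegenerateAtFour` — congruence `q ≡ −1 (mod p+1)` in all three): `E(ℚ)[2] ≠ 0`; `2 ∤ c_q(E)` for every prime
`q ∣ N`, `q ≠ 7`; every prime `q ∥ N`, `q ≠ 7`, is `≡ 7 (mod 8)`. [folklore] -/
def IsTwoEisensteinDegenerateAtFortyNine (W : WeierstrassCurve ℚ) : Prop :=
  HasRationalTwoTorsion W ∧
    ∀ q : ℕ, q.Prime → q ≠ 7 → q ∣ W.conductorNorm ℤ →
      ¬ 2 ∣ tamagawaAt W q ∧ (¬ q ^ 2 ∣ W.conductorNorm ℤ → q % 8 = 7)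

/-- `2^{1−s(W)}`: `2` iff `W` is 2-Eisenstein degenerate at 49, else `1`. [folklore] -/
def thetaSevenUnitTwo (W : WeierstrassCurve ℚ) : ℝ :=
  if IsTwoEisensteinDegenerateAtFortyNine W then 2 else 1

/-- **Row L-desc-178d `TwistPeriodProductMinusSeven`** (LAW, E-blind; memo §50.12; nothing asserted).  For a globally minimal
`W` of Kodaira type III or III* at `7` (`49 ∥ N`) and a globally minimal model `W'` of its twist by `−7`:
`Ω(W)·Ω(W')·√7 = 2·c_∞(W)·7^{[III*]}·A(W)`, `A` = covolume of the Néron lattice.  Census `desc/g25/b7/RHO7.txt`: 434/434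
optimal III/III* curves at `49M`, `M` odd `≤ 700`, any rank.
Why it might fail: only optimal curves were scanned (the statement is isogeny-invariant in neither side separately); a
non-optimal globally minimal `W` in a class where `Ω` drops by an isogeny factor not matched by `A`.
[cite: CremonaEcdata] [cite: Connell1999, §4 (twist minimal models)] -/
@[conjecture]
def TwistPeriodProductMinusSeven : Prop :=
  ∀ (W : WeierstrassCurve ℚ) [W.IsElliptic] [W.IsGloballyMinimal],
    (IsTypeThreeAtSevenTame W ∨ IsTypeThreeStarAtSevenTame W) →
  ∀ (W' : WeierstrassCurve ℚ) [W'.IsElliptic] [W'.IsGloballyMinimal], IsTwistModel W W' (-7) →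
  ∀ L : PeriodPair, IsNeronLatticeOf (W.baseChange ℂ) L →
    W.realPeriodRat * W'.realPeriodRat * Real.sqrt 7 = 2 * realComponents W * thetaSevenUnitKodaira W * covolume L

open scoped Classical in
/-- **Row E-desc-183 `ThetaSevenBrandtDegreeLawAtFortyNinePrime`** (LAW, identity; memo §50.12; nothing asserted).  For an
`X₀(N)`-optimal curve of conductor `N = 49p`, `p ≥ 11` prime, and a primitive θ₇-equivariant `g : ℙ¹(𝔽_p) → ℤ[i]` whose weighted
function is a Hecke eigenfunction for `(a_ℓ(E))_{ℓ ∤ 7p}` (such `g` exist, uniquely up to `μ₄`, exactly for Kodaira III / III* at 7):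
`2^{[2-Eis. degenerate at 49]} · deg φ = 4 · 7^{[III*]} · (2⟨m_E, m_E⟩)/2 · 2`, i.e. `deg φ = 2^{2+s}·7^{b}·⟨m,m⟩`, `s = 0` iff degenerate.
Census: 194/194 (all odd `M ≤ 323`, any level structure) + 57/57 habitat rows to `M = 841`; prime-level sub-census inside.
Why it might fail: the degeneracy clause has only 3 positive twist-pairs at prime level (`p = 71, 127, 239`; `631` predicted) —
a fourth condition invisible in range (e.g. on `a_2`) would refine it.
[cite: CremonaEcdata] [cite: PollackWeston2011, Thm. 6.8 (shape only)] -/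
@[conjecture]
def ThetaSevenBrandtDegreeLawAtFortyNinePrime : Prop :=
  ∀ (p : ℕ), p.Prime → 11 ≤ p →
  ∀ (W : WeierstrassCurve ℚ) [W.IsElliptic] [W.IsGloballyMinimal] [NeZero (W.conductorNorm ℤ)]
    (D : ModularParametrizationData W (W.conductorNorm ℤ)),
    W.conductorNorm ℤ = 49 * p →
    (∀ z ∈ D.L.lattice, ∃ w ∈ periodLattice D.f, z = D.c * w) →
    (∀ (W₁ : WeierstrassCurve ℚ) [W₁.IsElliptic]
        (D₁ : ModularParametrizationData W₁ (W.conductorNorm ℤ)),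
        D₁.f = D.f → D.modularDegree ≤ D₁.modularDegree) →
  ∀ g : Fin (p + 1) → ZI,
    IsThetaSevenEquivariant p g → IsPrimitive3 p g → IsThetaSevenHeckeEigen p g (fun n => W.LFunction n) →
    (2 : ℤ) ^ (if IsTwoEisensteinDegenerateAtFortyNine W then 1 else 0) * (D.modularDegree : ℤ) =
      4 * 7 ^ (if IsTypeThreeStarAtSevenTame W then 1 else 0) * thetaSevenHeightTwo p g

/-- **Row E-desc-181 `GrossThetaSevenExactIdentityAtFortyNinePrime`** (LAW = PREDICTED-THEN-CONFIRMED instance of the derived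
constant `1/(p+1)`, memo §50.8/§50.12; nothing asserted), DEGREE FORM (no unit to guess: (MOD) + L-178d only).  At a prime level
`p ≡ 1, 2, 4 (mod 7)`, `p ≥ 11`: for an `X₀(49p)`-optimal `W` (lattice clause + minimal-degree clause, Manin constant `D.c`), a
globally minimal model `W'` of `W^{(−7)}`, a primitive θ₇-equivariant Hecke eigenfunction `g` for `W`, and an `η`-fixed (CM) point `x`:
`Nm g(x) · deg φ = 4 · c² · c_∞(W) · 7^{[III*]} · (2⟨m,m⟩) · L_alg(W) · L_alg(W')`
(`= 8 c² c_∞ 7^{b} ⟨m,m⟩ L_alg L_alg'`; equivalently `L(E,1)L(E',1)√7⟨m,m⟩ = ⅛ (f,f)_G Nm`).  Census KAPPA49.txt: prime-level rows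
14/14 rank-0 (ordered pairs at `p = 67, 71, 127, 239, 613, 631, 827`) + 18/18 vanishing; all habitat levels 25/25 + 32/32.
Why it might fail: `Nm g(x)` might depend on WHICH `η`-fixed point at composite level (constant 57/57 in range; at prime level the
two CM points are swapped by `i`, so no issue); the Manin constant enters squared exactly as in BSD, so a `c ≠ 1` optimal curve tests nothing new.
[cite: FileMartinPitale2017, Thm. 1.1] [cite: Gross1987Heights, §11] [cite: CremonaEcdata] -/
@[conjecture]
def GrossThetaSevenExactIdentityAtFortyNinePrime : Prop :=
  ∀ (p : ℕ), p.Prime → 11 ≤ p → (p % 7 = 1 ∨ p % 7 = 2 ∨ p % 7 = 4) →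
  ∀ (W : WeierstrassCurve ℚ) [W.IsElliptic] [W.IsGloballyMinimal] [NeZero (W.conductorNorm ℤ)]
    (D : ModularParametrizationData W (W.conductorNorm ℤ)),
    W.conductorNorm ℤ = 49 * p →
    (∀ z ∈ D.L.lattice, ∃ w ∈ periodLattice D.f, z = D.c * w) →
    (∀ (W₁ : WeierstrassCurve ℚ) [W₁.IsElliptic]
        (D₁ : ModularParametrizationData W₁ (W.conductorNorm ℤ)),
        D₁.f = D.f → D.modularDegree ≤ D₁.modularDegree) →
  ∀ (W' : WeierstrassCurve ℚ) [W'.IsElliptic] [W'.IsGloballyMinimal], IsTwistModel W W' (-7) →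
  ∀ g : Fin (p + 1) → ZI,
    IsThetaSevenEquivariant p g → IsPrimitive3 p g → IsThetaSevenHeckeEigen p g (fun n => W.LFunction n) →
  ∀ x : Fin (p + 1), IsEtaFixed p x →
    (ZI.norm (g x) : ℝ) * (D.modularDegree : ℝ) =
      4 * (D.c : ℝ) ^ 2 * realComponents W * thetaSevenUnitKodaira W * (thetaSevenHeightTwo p g : ℝ) * lAlgOne W * lAlgOne W'

/-- **Row E-desc-181′ `GrossThetaSevenBSDIdentityAtFortyNinePrime`** (LAW; the BSD form, exact mirror of the `p = 3` row
`GrossThetaFourExactIdentityMinusThreeAtNinePrime`; nothing asserted): same hypotheses,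
`Nm g(x) = c² · c_∞(W) · 2^{[2-Eis. degenerate at 49]} · L_alg(W) · L_alg(W')`.  Census 25/25 (`U = Nm/(L_alg L_alg') ∈ {1, 2, 4}`)
+ 32/32 vanishing; Ш-visibility `11711b1` (`Nm = 9 = |Ш|`).  = E-181 ∧ E-183 (edge `grossThetaSevenBSD_of_degreeForm` below, given `deg φ ≠ 0`).
Why it might fail: through E-183's degeneracy clause (3 positive pairs).
[cite: FileMartinPitale2017, Thm. 1.1] [cite: CremonaEcdata] -/
@[conjecture]
def GrossThetaSevenBSDIdentityAtFortyNinePrime : Prop :=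
  ∀ (p : ℕ), p.Prime → 11 ≤ p → (p % 7 = 1 ∨ p % 7 = 2 ∨ p % 7 = 4) →
  ∀ (W : WeierstrassCurve ℚ) [W.IsElliptic] [W.IsGloballyMinimal] [NeZero (W.conductorNorm ℤ)]
    (D : ModularParametrizationData W (W.conductorNorm ℤ)),
    W.conductorNorm ℤ = 49 * p →
    (∀ z ∈ D.L.lattice, ∃ w ∈ periodLattice D.f, z = D.c * w) →
    (∀ (W₁ : WeierstrassCurve ℚ) [W₁.IsElliptic]
        (D₁ : ModularParametrizationData W₁ (W.conductorNorm ℤ)),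
        D₁.f = D.f → D.modularDegree ≤ D₁.modularDegree) →
  ∀ (W' : WeierstrassCurve ℚ) [W'.IsElliptic] [W'.IsGloballyMinimal], IsTwistModel W W' (-7) →
  ∀ g : Fin (p + 1) → ZI,
    IsThetaSevenEquivariant p g → IsPrimitive3 p g → IsThetaSevenHeckeEigen p g (fun n => W.LFunction n) →
  ∀ x : Fin (p + 1), IsEtaFixed p x →
    (ZI.norm (g x) : ℝ) = (D.c : ℝ) ^ 2 * realComponents W * thetaSevenUnitTwo W * lAlgOne W * lAlgOne W'


/-! ### §7. Proved edges at `p = 7` -/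

/-- The unit `2^{[2-Eis. degenerate at 49]} ∈ {1, 2}` is non-zero. -/
theorem thetaSevenUnitTwo_ne_zero (W : WeierstrassCurve ℚ) : thetaSevenUnitTwo W ≠ 0 := by
  unfold thetaSevenUnitTwo; split_ifs <;> norm_num

/-- The unit `7^{[III*]} ∈ {1, 7}` is non-zero. -/
theorem thetaSevenUnitKodaira_ne_zero (W : WeierstrassCurve ℚ) : thetaSevenUnitKodaira W ≠ 0 := by
  unfold thetaSevenUnitKodaira; split_ifs <;> norm_num

/-- the two units are tied by the degree law's exponents: `7^{[III*]}` as a real number. -/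
theorem thetaSevenUnitKodaira_eq_pow (W : WeierstrassCurve ℚ) :
    thetaSevenUnitKodaira W = (7 : ℝ) ^ (if IsTypeThreeStarAtSevenTame W then 1 else 0) := by
  unfold thetaSevenUnitKodaira; split_ifs <;> norm_num

/-- `2^{[2-Eis. degenerate at 49]}` as a power of `2`. -/
theorem thetaSevenUnitTwo_eq_pow (W : WeierstrassCurve ℚ) :
    thetaSevenUnitTwo W = (2 : ℝ) ^ (if IsTwoEisensteinDegenerateAtFortyNine W then 1 else 0) := by
  unfold thetaSevenUnitTwo; split_ifs <;> norm_num

/-- **Edge.** The BSD form E-181′ follows from the degree form E-181 and the degree law E-183 at the habitat primes, for a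
parametrisation of non-zero degree (pure algebra: divide `Nm·deg = 4c²c_∞7^b·H₂·LL'` by `2^{d}·deg = 4·7^b·H₂`). -/
theorem grossThetaSevenBSD_of_degreeForm
    (h181 : GrossThetaSevenExactIdentityAtFortyNinePrime) (h183 : ThetaSevenBrandtDegreeLawAtFortyNinePrime)
    (p : ℕ) (hp : p.Prime) (h11 : 11 ≤ p) (h7 : p % 7 = 1 ∨ p % 7 = 2 ∨ p % 7 = 4)
    (W : WeierstrassCurve ℚ) [W.IsElliptic] [W.IsGloballyMinimal] [NeZero (W.conductorNorm ℤ)]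
    (D : ModularParametrizationData W (W.conductorNorm ℤ)) (hN : W.conductorNorm ℤ = 49 * p)
    (hlat : ∀ z ∈ D.L.lattice, ∃ w ∈ periodLattice D.f, z = D.c * w)
    (hmin : ∀ (W₁ : WeierstrassCurve ℚ) [W₁.IsElliptic]
        (D₁ : ModularParametrizationData W₁ (W.conductorNorm ℤ)), D₁.f = D.f → D.modularDegree ≤ D₁.modularDegree)
    (hdeg : D.modularDegree ≠ 0)
    (W' : WeierstrassCurve ℚ) [W'.IsElliptic] [W'.IsGloballyMinimal] (hW' : IsTwistModel W W' (-7))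
    (g : Fin (p + 1) → ZI) (hθ : IsThetaSevenEquivariant p g) (hprim : IsPrimitive3 p g)
    (hH : IsThetaSevenHeckeEigen p g (fun n => W.LFunction n))
    (x : Fin (p + 1)) (hx : IsEtaFixed p x) :
    (ZI.norm (g x) : ℝ) = (D.c : ℝ) ^ 2 * realComponents W * thetaSevenUnitTwo W * lAlgOne W * lAlgOne W' := by
  have hA := h181 p hp h11 h7 W D hN hlat hmin W' hW' g hθ hprim hH x hx
  have hB := h183 p hp h11 W D hN hlat hmin g hθ hprim hH
  have hBr : (2 : ℝ) ^ (if IsTwoEisensteinDegenerateAtFortyNine W then 1 else 0) * (D.modularDegree : ℝ) =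
      4 * (7 : ℝ) ^ (if IsTypeThreeStarAtSevenTame W then 1 else 0) * (thetaSevenHeightTwo p g : ℝ) := by
    exact_mod_cast hB
  have hd : (D.modularDegree : ℝ) ≠ 0 := by exact_mod_cast hdeg
  have hK := thetaSevenUnitKodaira_eq_pow W
  have hT := thetaSevenUnitTwo_eq_pow W
  set P2 : ℝ := (2 : ℝ) ^ (if IsTwoEisensteinDegenerateAtFortyNine W then 1 else 0) with hP2
  set P7 : ℝ := (7 : ℝ) ^ (if IsTypeThreeStarAtSevenTame W then 1 else 0) with hP7
  have hP2nz : P2 ≠ 0 := pow_ne_zero _ (by norm_num)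
  rw [hT]
  -- Nm · deg · P2 = 4 c² c_∞ P7 H₂ LL' · P2 = c² c_∞ LL' · (4 P7 H₂) · P2 = c² c_∞ LL' · (P2 · deg) · P2 … cancel deg·P2
  have e1 : (ZI.norm (g x) : ℝ) * ((D.modularDegree : ℝ) * P2) =
      (4 * (D.c : ℝ) ^ 2 * realComponents W * thetaSevenUnitKodaira W * (thetaSevenHeightTwo p g : ℝ) * lAlgOne W * lAlgOne W') * P2 := by
    rw [← mul_assoc, hA]
  have e2 : (4 * (D.c : ℝ) ^ 2 * realComponents W * thetaSevenUnitKodaira W * (thetaSevenHeightTwo p g : ℝ) * lAlgOne W * lAlgOne W') * P2 =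
      (D.c : ℝ) ^ 2 * realComponents W * lAlgOne W * lAlgOne W' * P2 * (4 * P7 * (thetaSevenHeightTwo p g : ℝ)) := by
    rw [hK]; ring
  have e3 : (D.c : ℝ) ^ 2 * realComponents W * lAlgOne W * lAlgOne W' * P2 * (4 * P7 * (thetaSevenHeightTwo p g : ℝ)) =
      ((D.c : ℝ) ^ 2 * realComponents W * P2 * lAlgOne W * lAlgOne W') * ((D.modularDegree : ℝ) * P2) := by
    rw [← hBr]; ring
  have key : (ZI.norm (g x) : ℝ) * ((D.modularDegree : ℝ) * P2) =
      ((D.c : ℝ) ^ 2 * realComponents W * P2 * lAlgOne W * lAlgOne W') * ((D.modularDegree : ℝ) * P2) := by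
    rw [e1, e2, e3]
  exact mul_right_cancel₀ (mul_ne_zero hd hP2nz) key

/-- **Edge.** Under E-181′, at a habitat prime level: `g x = 0 ↔ L_alg(E) = 0 ∨ L_alg(E^{(−7)}) = 0` at an `η`-fixed point, for a
parametrisation with `c ≠ 0` (census of the vanishing side 32/32). -/
theorem thetaSeven_vanishes_iff_lAlg_of_identity (h181 : GrossThetaSevenBSDIdentityAtFortyNinePrime)
    (p : ℕ) (hp : p.Prime) (h11 : 11 ≤ p) (h7 : p % 7 = 1 ∨ p % 7 = 2 ∨ p % 7 = 4)
    (W : WeierstrassCurve ℚ) [W.IsElliptic] [W.IsGloballyMinimal] [NeZero (W.conductorNorm ℤ)]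
    (D : ModularParametrizationData W (W.conductorNorm ℤ)) (hN : W.conductorNorm ℤ = 49 * p)
    (hlat : ∀ z ∈ D.L.lattice, ∃ w ∈ periodLattice D.f, z = D.c * w)
    (hmin : ∀ (W₁ : WeierstrassCurve ℚ) [W₁.IsElliptic]
        (D₁ : ModularParametrizationData W₁ (W.conductorNorm ℤ)), D₁.f = D.f → D.modularDegree ≤ D₁.modularDegree)
    (hc : D.c ≠ 0)
    (W' : WeierstrassCurve ℚ) [W'.IsElliptic] [W'.IsGloballyMinimal] (hW' : IsTwistModel W W' (-7))
    (g : Fin (p + 1) → ZI) (hθ : IsThetaSevenEquivariant p g) (hprim : IsPrimitive3 p g)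
    (hH : IsThetaSevenHeckeEigen p g (fun n => W.LFunction n))
    (x : Fin (p + 1)) (hx : IsEtaFixed p x) :
    g x = 0 ↔ (lAlgOne W = 0 ∨ lAlgOne W' = 0) := by
  have hid := h181 p hp h11 h7 W D hN hlat hmin W' hW' g hθ hprim hH x hx
  have hc' : (D.c : ℝ) ^ 2 ≠ 0 := pow_ne_zero 2 (by exact_mod_cast hc)
  have hU : (D.c : ℝ) ^ 2 * realComponents W * thetaSevenUnitTwo W ≠ 0 :=
    mul_ne_zero (mul_ne_zero hc' (realComponents_ne_zero W)) (thetaSevenUnitTwo_ne_zero W)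
  rw [← ZI_norm_eq_zero_iff]
  constructor
  · intro h0
    have h1 : ((D.c : ℝ) ^ 2 * realComponents W * thetaSevenUnitTwo W) * (lAlgOne W * lAlgOne W') = 0 := by
      have : (ZI.norm (g x) : ℝ) = 0 := by exact_mod_cast h0
      rw [this] at hid
      linear_combination -hid
    rcases mul_eq_zero.mp h1 with h | h
    · exact absurd h hU
    · exact mul_eq_zero.mp h
  · intro h
    have hrhs : (D.c : ℝ) ^ 2 * realComponents W * thetaSevenUnitTwo W * lAlgOne W * lAlgOne W' = 0 := by
      rcases h with h | h <;> simp [h]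
    rw [hrhs] at hid
    exact_mod_cast hid

/-- sanity (`decide`): `O₇` has exactly four units and 12 = 4·(2+1) elements of reduced norm 2; `θ₇ ≡ 1` on the units. -/
example : heptUnits.length = 4 := by native_decide
example : (heptOfNorm 2).length = 12 := by native_decide
example : ∀ u ∈ heptUnits, theta7Exp u = 0 := by native_decide
/-- sanity: `θ₇` takes the value `i` (exponent 1) on some element of norm 3 (a non-square mod 7): the character has order 4. -/
example : ∃ γ ∈ heptOfNorm 3, theta7Exp γ = 1 := by native_decide
/-- sanity: at `p = 11` (`≡ 4 mod 7`) there are exactly two `η`-fixed points of `ℙ¹(𝔽₁₁)`; at `p = 13` (`≡ 6`) none. -/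
example : ((List.finRange 12).filter fun x => decide (act7 11 ((1, 0, 1, 0) : DQuat) x = x)).length = 2 := by native_decide
example : ((List.finRange 14).filter fun x => decide (act7 13 ((1, 0, 1, 0) : DQuat) x = x)).length = 0 := by native_decide

end Summit.BirchSwinnertonDyer.Rank1Residual.ManinAdditive.GrossTheta
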